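import Mathlib
import HarnessLib
import Summits.NavierStokesRegularity.NavierStokesRegularity.Theorems.PoloidalWindowDoorLrcModEntireHorizontalGerm

/-!
# Route `PoloidalWindowDoor`, item `LrcModEntire` (stmt-NavierStokesRegularity-20428), cell (Q4) of the (TH) column —
# THE HORIZONTAL GERM ENDGAME AT A GENERAL TIME `t₀ < 0`

Cell ns-regularity-ideate, stub-worker seat ns-poloidal-K2-p2 g16 under the LEAD of item 20428 (ns-poloidal-K2-p3 g17);
`--supports stmt-NavierStokesRegularity-20428 --as helper`.  LEAD g16's `…HorizontalGerm` (brick E1 of T2B-g16 §4) is written on the slice `t = −1`; the time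
dichotomy of T2B-g17 §1 / §5(5f) runs the LINE lever at a nearby time `−1+τ` («if the base web `W_τ(·,0)` is straight the g16 LINE lever kills … at any
non-sonic τ»).  This file re-types the endgame at a general time `t₀ < 0` — the proofs are LEAD's, with `−1 ↦ t₀` (all tree inputs
`analyticOnNhd_slice`, `curl_eq_on_planeShear`, `curl_translate_of_fderiv_eq_zero_on`, `eq_zero_of_curl_translate_eq_slice` are time-general):

* `fderiv_curl_eq_zero_of_horizontalDeriv_at` — (TH) slab slope form at time `t₀`, poloidal slice, `∂_e v₂(t₀,·) = 0` on the slab ⇒ `D(curl v(t₀))[e] = 0` there;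
* `eq_zero_of_horizontalDeriv_two_eq_zero_at` — hence `v ≡ 0` (vorticity translation germ on one slice);
* ★ `false_of_local_horizontalDeriv_two_eq_zero_at` — local form: `∂_e v₂(t₀,·) = 0` on SOME nonempty open set (the slice is real-analytic) and a non-zero hot value
  `v₂(−1,0) ≠ 0` are contradictory; binder currency `hslabU : ∀ t, |t+1| < ρ → …` with `|t₀ + 1| < ρ`.

WHAT THIS IS NOT: not a claim about Navier–Stokes regularity; the time-`t₀` form of an existing Liouville brick for the research cells (Q4-*) of line twist_split;
items 20428 / 19708 / 27893 OPEN (bears_on LADDER-NS N0).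
-/

noncomputable section

-- the summit and its single sub-problem share the name (CONVENTIONS §1), as in every Theorems file
set_option linter.dupNamespace false

namespace Summit.NavierStokesRegularity.NavierStokesRegularity.Theorems.PoloidalWindowDoorLrcModEntireHorizontalGermAtTime

open Set Function Filter Topology Metric
open scoped RealInnerProductSpace InnerProductSpace ContDiff
open Literature.Analysis Literature.Analysis.FluidPDE
open Summit.NavierStokesRegularity.NavierStokesRegularity.Theorems.LocalSineTubeDoorProfileAlignedWindowRigidityAncient
open Summit.NavierStokesRegularity.NavierStokesRegularity.Theorems.PoloidalWindowDoorPoloidalWindowRigidityVorticityTranslate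
open Summit.NavierStokesRegularity.NavierStokesRegularity.Theorems.PoloidalWindowDoorPoloidalWindowRigidityLocalVorticitySymmetry
open Summit.NavierStokesRegularity.NavierStokesRegularity.Theorems.PoloidalWindowDoorLrcModEntireTwistingTHPlaneOscillationLink
open Summit.NavierStokesRegularity.NavierStokesRegularity.Theorems.PoloidalWindowDoorLrcModEntireHorizontalGerm

variable {C : ℝ} {v : ℝ → EuclideanSpace ℝ (Fin 3) → EuclideanSpace ℝ (Fin 3)}

section Class

variable (hrate : HasTypeITimeDecay C v)
  (hcont : ContinuousOn (uncurry v) (Iio (0 : ℝ) ×ˢ univ))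
  (hmild : ∀ s t : ℝ, s < t → t < 0 → ∀ x,
    v t x = UnboundedOperators.heatExtension (v s) (t - s) x - oseenDuhamel 1 s v v t x)
  (hdiv : ∀ t < 0, VectorCalculus.IsDivFree (v t))
  (hpol : ∀ s < 0, ∀ y, ⟪curl (v s) y, EuclideanSpace.single 2 1⟫_ℝ = 0)

include hrate hcont hmild

/-- **Time-`t₀` form of `…HorizontalGerm.fderiv_curl_eq_zero_of_horizontalDeriv`** (LEAD g16's proof with `−1 ↦ t₀`). -/
theorem fderiv_curl_eq_zero_of_horizontalDeriv_at {t₀ : ℝ} (ht₀ : t₀ < 0)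
    (hpol1 : ∀ y, ⟪curl (v t₀) y, EuclideanSpace.single 2 1⟫_ℝ = 0)
    {μ : ℝ → ℝ} {ρ : ℝ}
    (hslope : ∀ x : EuclideanSpace ℝ (Fin 3), |x 2| < ρ → ∀ b : Fin 3, b ≠ 2 →
      fderiv ℝ (v t₀) x (EuclideanSpace.single 2 1) b = μ (x 2) * fderiv ℝ (v t₀) x (EuclideanSpace.single b 1) 2)
    {e : EuclideanSpace ℝ (Fin 3)} (he2 : e 2 = 0)
    (hη : ∀ x : EuclideanSpace ℝ (Fin 3), |x 2| < ρ → fderiv ℝ (fun y => v t₀ y 2) x e = 0)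
    {x : EuclideanSpace ℝ (Fin 3)} (hx : |x 2| < ρ) : fderiv ℝ (curl (v t₀)) x e = 0 := by
  have hs : t₀ < 0 := ht₀
  set θ : EuclideanSpace ℝ (Fin 3) → ℝ := fun y => v t₀ y 2 with hθ
  -- analyticity / smoothness of the slice, of `θ`, and of the vorticity
  have hanV : AnalyticOnNhd ℝ (v t₀) univ := analyticOnNhd_slice hcont (bdd_of_hasTypeITimeDecay hrate) hmild hs
  have hVd : Differentiable ℝ (v t₀) := fun y => (hanV y (mem_univ _)).differentiableAt
  have hanθ : AnalyticOnNhd ℝ θ univ := fun y _ =>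
    ((EuclideanSpace.proj (2 : Fin 3) : EuclideanSpace ℝ (Fin 3) →L[ℝ] ℝ).analyticAt _).comp (hanV y (mem_univ _))
  have hθ2 : ∀ y, ContDiffAt ℝ 2 θ y := fun y => (hanθ y (mem_univ _)).contDiffAt.of_le le_top
  have hanΩ : AnalyticOnNhd ℝ (curl (v t₀)) univ := by
    rw [curl_eq_curlCLM_comp]; exact curlCLM.comp_analyticOnNhd hanV.fderiv
  have hΩd : Differentiable ℝ (curl (v t₀)) := fun y => (hanΩ y (mem_univ _)).differentiableAt
  -- coordinates of a Fréchet derivative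
  have hcoord : ∀ {w : EuclideanSpace ℝ (Fin 3) → EuclideanSpace ℝ (Fin 3)} {y : EuclideanSpace ℝ (Fin 3)},
      DifferentiableAt ℝ w y → ∀ (i : Fin 3) (u : EuclideanSpace ℝ (Fin 3)), fderiv ℝ (fun y' => w y' i) y u = (fderiv ℝ w y u) i := by
    intro w y hw i u
    have h := ((EuclideanSpace.proj i : EuclideanSpace ℝ (Fin 3) →L[ℝ] ℝ).hasFDerivAt.comp y hw.hasFDerivAt)
    rw [show (fun y' => w y' i) = (EuclideanSpace.proj i : EuclideanSpace ℝ (Fin 3) →L[ℝ] ℝ) ∘ w from rfl, h.fderiv]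
    rfl
  -- the open slab
  have hopen : IsOpen {y : EuclideanSpace ℝ (Fin 3) | |y 2| < ρ} :=
    isOpen_lt (continuous_abs.comp (EuclideanSpace.proj (2 : Fin 3)).continuous) continuous_const
  -- `∂_e θ ≡ 0` near every point of the slab, hence `∂_e(∂_u θ) = 0` there
  have hη_ev : ∀ {y : EuclideanSpace ℝ (Fin 3)}, |y 2| < ρ → (fun y' => fderiv ℝ θ y' e) =ᶠ[𝓝 y] fun _ => 0 := by
    intro y hy
    filter_upwards [hopen.mem_nhds hy] with y' hy'
    exact hη y' hy'
  have hmix : ∀ {y : EuclideanSpace ℝ (Fin 3)}, |y 2| < ρ → ∀ u : EuclideanSpace ℝ (Fin 3),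
      fderiv ℝ (fun y' => fderiv ℝ θ y' u) y e = 0 := fun hy u =>
    fderiv_fderiv_apply_eq_zero_of_eventually (hθ2 _) (hη_ev hy) u
  -- the vorticity on the slab: `ω = ((1−μ)∂₁θ, −(1−μ)∂₀θ, 0)`
  have hpol' : ∀ y : EuclideanSpace ℝ (Fin 3), curl (v t₀) y 2 = 0 := fun y => by
    have h := hpol1 y
    rw [EuclideanSpace.inner_single_right] at h
    simpa using h
  have hcurl : ∀ y : EuclideanSpace ℝ (Fin 3), |y 2| < ρ →
      curl (v t₀) y 0 = (1 - μ (y 2)) * fderiv ℝ θ y (EuclideanSpace.single 1 1) ∧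
      curl (v t₀) y 1 = -(1 - μ (y 2)) * fderiv ℝ θ y (EuclideanSpace.single 0 1) ∧
      curl (v t₀) y 2 = 0 := by
    intro y hy
    have hsl : ∀ y' : EuclideanSpace ℝ (Fin 3), y' 2 = y 2 → ∀ b : Fin 3, b ≠ 2 →
        fderiv ℝ (v t₀) y' (EuclideanSpace.single 2 1) b = μ (y 2) * fderiv ℝ (v t₀) y' (EuclideanSpace.single b 1) 2 := by
      intro y' hy' b hb
      have h := hslope y' (by rw [hy']; exact hy) b hb
      rwa [hy'] at h
    have hpl : ∀ y' : EuclideanSpace ℝ (Fin 3), y' 2 = y 2 → curl (v t₀) y' 2 = 0 := fun y' _ => hpol' y'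
    obtain ⟨h0, h1, h2⟩ := curl_eq_on_planeShear (V := v t₀) (c := y 2) (μ := μ (y 2)) hsl hpl (y := y) rfl
    refine ⟨?_, ?_, h2⟩
    · rw [h0, hθ, hcoord (hVd y) 2]
    · rw [h1, hθ, hcoord (hVd y) 2]
  -- along the horizontal line `x + l e` the height is constant
  have hline2 : ∀ l : ℝ, (x + l • e) 2 = x 2 := fun l => by simp [he2]
  have hlineIn : ∀ l : ℝ, |(x + l • e) 2| < ρ := fun l => by rw [hline2]; exact hx
  -- the `e`-derivative of a function along the line, as a derivative in `l`
  have hderiv_line : ∀ {g : EuclideanSpace ℝ (Fin 3) → ℝ}, DifferentiableAt ℝ g x →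
      fderiv ℝ g x e = deriv (fun l : ℝ => g (x + l • e)) 0 := by
    intro g hg
    have h1 : HasFDerivAt g (fderiv ℝ g x) (x + (0 : ℝ) • e) := by simpa using hg.hasFDerivAt
    have h2 : HasDerivAt (fun l : ℝ => x + l • e) e 0 := by
      simpa using ((hasDerivAt_id (0 : ℝ)).smul_const e).const_add x
    exact (h1.comp_hasDerivAt 0 h2).deriv.symm
  -- componentwise computation of `D(curl v(−1))(x)[e]`
  have hgi : ∀ i : Fin 3, DifferentiableAt ℝ (fun y => curl (v t₀) y i) x := fun i =>
    (((EuclideanSpace.proj i : EuclideanSpace ℝ (Fin 3) →L[ℝ] ℝ).differentiableAt).comp x (hΩd x))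
  have hDθ : DifferentiableAt ℝ (fderiv ℝ θ) x :=
    (((hθ2 x).fderiv_right (m := 1) (by norm_num)).differentiableAt (by norm_num))
  have hcomp0 : (fderiv ℝ (curl (v t₀)) x e) 0 = 0 := by
    rw [← hcoord (hΩd x) 0, hderiv_line (hgi 0)]
    have hfun : (fun l : ℝ => curl (v t₀) (x + l • e) 0) =
        fun l => (1 - μ (x 2)) * fderiv ℝ θ (x + l • e) (EuclideanSpace.single 1 1) := by
      funext l
      rw [(hcurl _ (hlineIn l)).1, hline2]
    have hg : DifferentiableAt ℝ (fun y => fderiv ℝ θ y (EuclideanSpace.single 1 1)) x :=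
      hDθ.clm_apply (differentiableAt_const _)
    rw [hfun, deriv_const_mul_field, ← hderiv_line hg, hmix hx]
    simp
  have hcomp1 : (fderiv ℝ (curl (v t₀)) x e) 1 = 0 := by
    rw [← hcoord (hΩd x) 1, hderiv_line (hgi 1)]
    have hfun : (fun l : ℝ => curl (v t₀) (x + l • e) 1) =
        fun l => -(1 - μ (x 2)) * fderiv ℝ θ (x + l • e) (EuclideanSpace.single 0 1) := by
      funext l
      rw [(hcurl _ (hlineIn l)).2.1, hline2]
    have hg : DifferentiableAt ℝ (fun y => fderiv ℝ θ y (EuclideanSpace.single 0 1)) x :=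
      hDθ.clm_apply (differentiableAt_const _)
    rw [hfun, deriv_const_mul_field, ← hderiv_line hg, hmix hx]
    simp
  have hcomp2 : (fderiv ℝ (curl (v t₀)) x e) 2 = 0 := by
    rw [← hcoord (hΩd x) 2, hderiv_line (hgi 2)]
    have hfun : (fun l : ℝ => curl (v t₀) (x + l • e) 2) = fun _ => 0 := by
      funext l; exact (hcurl _ (hlineIn l)).2.2
    rw [hfun, deriv_const]
  ext i
  fin_cases i
  · simpa using hcomp0
  · simpa using hcomp1
  · simpa using hcomp2

include hdiv hpol

/-- **Time-`t₀` form of `…HorizontalGerm.eq_zero_of_horizontalDeriv_two_eq_zero`:** a (TH) class profile with `∂_e v₂(t₀,·) ≡ 0` on a slab (`e ≠ 0` horizontal)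
is trivial. -/
theorem eq_zero_of_horizontalDeriv_two_eq_zero_at {t₀ : ℝ} (ht₀ : t₀ < 0) {μ : ℝ → ℝ} {ρ : ℝ} (hρ : 0 < ρ)
    (hslope : ∀ x : EuclideanSpace ℝ (Fin 3), |x 2| < ρ → ∀ b : Fin 3, b ≠ 2 →
      fderiv ℝ (v t₀) x (EuclideanSpace.single 2 1) b = μ (x 2) * fderiv ℝ (v t₀) x (EuclideanSpace.single b 1) 2)
    {e : EuclideanSpace ℝ (Fin 3)} (he : e ≠ 0) (he2 : e 2 = 0)
    (hη : ∀ x : EuclideanSpace ℝ (Fin 3), |x 2| < ρ → fderiv ℝ (fun y => v t₀ y 2) x e = 0) :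
    ∀ t < 0, ∀ x, v t x = 0 := by
  have hopen : IsOpen {y : EuclideanSpace ℝ (Fin 3) | |y 2| < ρ} :=
    isOpen_lt (continuous_abs.comp (EuclideanSpace.proj (2 : Fin 3)).continuous) continuous_const
  have hne : ({y : EuclideanSpace ℝ (Fin 3) | |y 2| < ρ}).Nonempty := ⟨0, by simpa using hρ⟩
  have hgerm : ∀ y ∈ {y : EuclideanSpace ℝ (Fin 3) | |y 2| < ρ}, fderiv ℝ (curl (v t₀)) y e = 0 := fun y hy =>
    fderiv_curl_eq_zero_of_horizontalDeriv_at hrate hcont hmild ht₀ (hpol t₀ ht₀) hslope he2 hη hy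
  exact eq_zero_of_curl_translate_eq_slice hrate hcont hmild hdiv ht₀ he
    (curl_translate_of_fderiv_eq_zero_on hrate hcont hmild ht₀ hopen hne hgerm)

/-- ★ **Local time-`t₀` endgame in binder currency:** registered slab slope form `hslabU` (`∀ t, |t+1| < ρ → …`), a time `t₀ < 0` with `|t₀ + 1| < ρ`,
`∂_e v₂(t₀,·) = 0` on SOME nonempty open set, and a non-zero hot value `v₂(−1, 0) ≠ 0` ⇒ `False`. -/
theorem false_of_local_horizontalDeriv_two_eq_zero_at {t₀ : ℝ} (ht₀ : t₀ < 0) {m : ℝ → ℝ → ℝ} {ρ : ℝ} (hρ : 0 < ρ) (ht₀ρ : |t₀ + 1| < ρ)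
    (hslabU : ∀ t : ℝ, |t + 1| < ρ → ∀ x : EuclideanSpace ℝ (Fin 3), |x 2| < ρ → ∀ b : Fin 3, b ≠ 2 →
      fderiv ℝ (v t) x (EuclideanSpace.single 2 1) b = m t (x 2) * fderiv ℝ (v t) x (EuclideanSpace.single b 1) 2)
    {e : EuclideanSpace ℝ (Fin 3)} (he : e ≠ 0) (he2 : e 2 = 0)
    {V : Set (EuclideanSpace ℝ (Fin 3))} (hV : IsOpen V) (hVne : V.Nonempty)
    (hη : ∀ x ∈ V, fderiv ℝ (fun y => v t₀ y 2) x e = 0) (hN : v (-1) 0 2 ≠ 0) : False := by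
  -- the local germ spreads to `ℝ³` (the slice is real-analytic)
  have hanV : AnalyticOnNhd ℝ (v t₀) univ := analyticOnNhd_slice hcont (bdd_of_hasTypeITimeDecay hrate) hmild ht₀
  have hanθ : AnalyticOnNhd ℝ (fun y => v t₀ y 2) univ := fun y _ =>
    ((EuclideanSpace.proj (2 : Fin 3) : EuclideanSpace ℝ (Fin 3) →L[ℝ] ℝ).analyticAt _).comp (hanV y (mem_univ _))
  have hgan : AnalyticOnNhd ℝ (fun x => fderiv ℝ (fun y => v t₀ y 2) x e) univ := fun x hx =>
    ((ContinuousLinearMap.apply ℝ ℝ e).analyticAt _).comp (hanθ.fderiv x hx)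
  obtain ⟨x₀, hx₀⟩ := hVne
  have hev : (fun x => fderiv ℝ (fun y => v t₀ y 2) x e) =ᶠ[𝓝 x₀] 0 := by
    filter_upwards [hV.mem_nhds hx₀] with x hx
    exact hη x hx
  have hall : ∀ x : EuclideanSpace ℝ (Fin 3), fderiv ℝ (fun y => v t₀ y 2) x e = 0 := fun x => by
    have h := hgan.eqOn_zero_of_preconnected_of_eventuallyEq_zero isPreconnected_univ (mem_univ x₀) hev (mem_univ x)
    simpa using h
  have hzero := eq_zero_of_horizontalDeriv_two_eq_zero_at hrate hcont hmild hdiv hpol ht₀ hρ (μ := m t₀)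
    (fun x hx b hb => hslabU t₀ ht₀ρ x hx b hb) he he2 (fun x _ => hall x)
  apply hN
  rw [hzero (-1) (by norm_num) 0]
  rfl

end Class

end Summit.NavierStokesRegularity.NavierStokesRegularity.Theorems.PoloidalWindowDoorLrcModEntireHorizontalGermAtTime

end
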